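import Summits.KontsevichZagierPeriods.KontsevichZagierPeriods.Theorems.RootDecompRationalCubeDichotomySimpleBranchS1

/-!
# Route RootDecompRationalCubeDichotomy — item 27842 `PiRationalisationSimpleBranch` PROVED, part 11/11 (`RootDecompRationalCubeDichotomySimpleBranchInnerResidue`)

Theorems-split (≤ 400 lines each, sequential imports) of the decomp-kz lens-2 gen-4 file
`run/shared/lean/pub/decomp-kz/decomp-kz-lens-2/g4/PiRationalisationSimpleBranch27842.lean` (2963 lines; lens farm rc 0, writer re-check
rc 0 audit proof-of-item closed:true, critic g2 by-name probe std axioms, 2026-08-30T05:27:57Z/06:02:52Z). The rung: for simple-branch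
Nash data (`F(x,g) = 0`, `∂_z F(x,g) ≠ 0` on the closed cube) `[π]^K·[s] ∈ relations ⊔ ⟨rational closed-cube sector⟩` for all `K ≥ 1` —
root isolation on rational sub-boxes, the Green band move (planar Stokes inside the four moves), the half winding number ≡ 4[A] ≡ [π],
box rescaling, and `PiTimesSector` (item 26388, landed). The final part closes the ROUTE ITEM by name
(`piRationalisationSimpleBranch_proof`). Sector lemmas are REUSED from the landed rung-24903 file `…PiRationalisationSqrtMoves`.
[Kontsevich–Zagier 2001 §1.2; argument principle] Standard axioms, 0 sorry.
-/

noncomputable section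

set_option linter.dupNamespace false

namespace Summit.KontsevichZagierPeriods.RootDecompRationalCubeDichotomy.Rung27842.SimpleBranch

open Summit.KontsevichZagierPeriods.RootDecompRationalCubeDichotomy.Rung24903
  (piRep_mul_mem_sup_of_mem_closure piRep_mul_mem_sup piIter_mem_sup)
open MeasureTheory Set MvPolynomial
open Literature.NumberTheory.Transcendental Literature.NumberTheory.Transcendental.KZ
open Literature.ModelTheory.ExponentialFields (IsSemialgebraic)
open Summit.KontsevichZagierPeriods.KontsevichZagierPeriods.Theses.RootDecompRationalCubeDichotomy
  (PiTimesSector PiRationalisationSimpleBranch)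
open Summit.KontsevichZagierPeriods.RootDecompRationalCubeDichotomy.Rung27842.RootIso

/-! ## Scratch S2: `InnerResidue` — Green for the remainder of the residue form on the inner square -/

/-- A quotient of `ℚ`-polynomials in `(z, φ z)` is semialgebraic in `z` wherever the denominator does not vanish. -/
theorem sa_polyQuot_graph {m : ℕ} {S : Set (Fin (m + 1) → ℝ)} (hS : IsSemialgebraic ℚ S)
    {φ : (Fin (m + 1) → ℝ) → ℝ} (hφ : IsSemialgebraicFunOn ℚ S φ) (P Q : MvPolynomial (Fin (m + 2)) ℚ)
    (hQ : ∀ z ∈ S, aeval (Fin.snoc z (φ z) : Fin (m + 2) → ℝ) Q ≠ 0) :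
    IsSemialgebraicFunOn ℚ S (fun z => aeval (Fin.snoc z (φ z) : Fin (m + 2) → ℝ) P /
      aeval (Fin.snoc z (φ z) : Fin (m + 2) → ℝ) Q) :=
  IsSemialgebraicFunOn.comp_isSemialgebraicMapOn_holds
    (isSemialgebraicFunOn_aeval_div_aeval
      (Literature.ModelTheory.ExponentialFields.isSemialgebraic_setOf_eval_ne_zero (k := ℚ) (R := ℝ) Q) P Q
      (fun _ hW => hW))
    (isSemialgebraicMapOn_snoc_fun hS hφ) (fun z hz => hQ z hz)

/-- **S2 `InnerResidue` HOLDS** (the residue computation on the inner square). -/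
theorem innerResidue_holds : InnerResidue := by
  intro n g U piece F lo hi a b c ε hU hsub hg han hlohi hdom hint hF hFz hiso
  have hab : (a:ℝ) < b := by exact_mod_cast hiso.1
  have hε : (0:ℝ) < ε := by exact_mod_cast hiso.2.1
  have hεc : (ε:ℝ) < c := by exact_mod_cast hiso.2.2.1
  have hc : (0:ℝ) < c := hε.trans hεc
  have hmarg := hiso.2.2.2.1
  have hτc : IsCompact piece.domain := by rw [hdom]; exact isCompact_univ_pi fun _ => isCompact_Icc
  have hτs : IsSemialgebraic ℚ piece.domain := piece.isSemialgebraic_domain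
  have hgτ : IsSemialgebraicFunOn ℚ piece.domain g := hg.mono hsub hτs
  have hgc : ContinuousOn g piece.domain := fun x hx => (han x (hsub hx)).continuousAt.continuousWithinAt
  -- bound functions on the base
  have hKε : IsSemialgebraicFunOn ℚ piece.domain (fun _ => (ε:ℝ)) := isSemialgebraicFunOn_ratCast hτs ε
  have hK0 : IsSemialgebraicFunOn ℚ piece.domain (fun _ => (0:ℝ)) :=
    (isSemialgebraicFunOn_ratCast hτs 0).congr (fun _ _ => by simp)
  have hgm : IsSemialgebraicFunOn ℚ piece.domain (fun x => g x - ε) := IsSemialgebraicFunOn.sub_holds hgτ hKε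
  have hgp : IsSemialgebraicFunOn ℚ piece.domain (fun x => g x + ε) := IsSemialgebraicFunOn.add_holds hgτ hKε
  have hgmc : ContinuousOn (fun x => g x - (ε:ℝ)) piece.domain := hgc.sub continuousOn_const
  have hgpc : ContinuousOn (fun x => g x + (ε:ℝ)) piece.domain := hgc.add continuousOn_const
  have cc : ∀ r : ℝ, ContinuousOn (fun _ : Fin n → ℝ => r) piece.domain := fun r => continuousOn_const
  -- the two edge bases: `V = τ × [0, ε]` (vertical edges) and `T = {(x,u) : |u - g x| ≤ ε}` (top/bottom edges)
  have hV : IsSemialgebraic ℚ (KZlog.band piece.domain (fun _ => (0:ℝ)) (fun _ => (ε:ℝ))) :=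
    KZlog.isSemialgebraic_band hK0 hKε
  have hT : IsSemialgebraic ℚ (KZlog.band piece.domain (fun x => g x - ε) (fun x => g x + ε)) :=
    KZlog.isSemialgebraic_band hgm hgp
  have hVc : IsCompact (KZlog.band piece.domain (fun _ => (0:ℝ)) (fun _ => (ε:ℝ))) := isCompact_band hτc (cc _) (cc _)
  have hTc : IsCompact (KZlog.band piece.domain (fun x => g x - ε) (fun x => g x + ε)) := isCompact_band hτc hgmc hgpc
  have sub0 : ∀ {S : Set (Fin (n + 1) → ℝ)} {α β : (Fin n → ℝ) → ℝ}, S = KZlog.band piece.domain α β →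
      S ⊆ {z | Fin.init z ∈ piece.domain} := fun h => h ▸ KZ.band_subset_setOf_init_mem
  have saK : ∀ {S : Set (Fin (n + 1) → ℝ)}, IsSemialgebraic ℚ S → ∀ q : ℚ, IsSemialgebraicFunOn ℚ S (fun _ => (q:ℝ)) :=
    fun hS q => isSemialgebraicFunOn_ratCast hS q
  have saK0 : ∀ {S : Set (Fin (n + 1) → ℝ)}, IsSemialgebraic ℚ S → IsSemialgebraicFunOn ℚ S (fun _ => (0:ℝ)) :=
    fun hS => (isSemialgebraicFunOn_ratCast hS 0).congr (fun _ _ => by simp)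
  have saG : ∀ {S : Set (Fin (n + 1) → ℝ)}, IsSemialgebraic ℚ S → S ⊆ {z | Fin.init z ∈ piece.domain} →
      IsSemialgebraicFunOn ℚ S (fun y => g (Fin.init y)) :=
    fun hS hSs => hgτ.comp_init_mono hS hSs
  have saGp : ∀ {S : Set (Fin (n + 1) → ℝ)}, IsSemialgebraic ℚ S → S ⊆ {z | Fin.init z ∈ piece.domain} →
      IsSemialgebraicFunOn ℚ S (fun y => g (Fin.init y) + (ε:ℝ)) :=
    fun hS hSs => hgp.comp_init_mono hS hSs
  have saGm : ∀ {S : Set (Fin (n + 1) → ℝ)}, IsSemialgebraic ℚ S → S ⊆ {z | Fin.init z ∈ piece.domain} →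
      IsSemialgebraicFunOn ℚ S (fun y => g (Fin.init y) - (ε:ℝ)) :=
    fun hS hSs => hgm.comp_init_mono hS hSs
  have coG : ∀ {S : Set (Fin (n + 1) → ℝ)}, S ⊆ {z | Fin.init z ∈ piece.domain} →
      ContinuousOn (fun y : Fin (n + 1) → ℝ => g (Fin.init y)) S :=
    fun hSs => hgc.comp continuous_init'.continuousOn fun z hz => hSs hz
  have coGp : ∀ {S : Set (Fin (n + 1) → ℝ)}, S ⊆ {z | Fin.init z ∈ piece.domain} →
      ContinuousOn (fun y : Fin (n + 1) → ℝ => g (Fin.init y) + (ε:ℝ)) S :=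
    fun hSs => hgpc.comp continuous_init'.continuousOn fun z hz => hSs hz
  have coGm : ∀ {S : Set (Fin (n + 1) → ℝ)}, S ⊆ {z | Fin.init z ∈ piece.domain} →
      ContinuousOn (fun y : Fin (n + 1) → ℝ => g (Fin.init y) - (ε:ℝ)) S :=
    fun hSs => hgmc.comp continuous_init'.continuousOn fun z hz => hSs hz
  have coK : ∀ {S : Set (Fin (n + 1) → ℝ)} (r : ℝ), ContinuousOn (fun _ : Fin (n + 1) → ℝ => r) S :=
    fun r => continuousOn_const
  -- the residue form `h = y/(w - y) + Nr/Dr`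
  obtain ⟨Nr, Dr, rf1, rf2, rf3⟩ := ReIm.exists_residueForm F
  -- `F ≠ 0` on the closed square strip off the root, `Dr ≠ 0` on the whole closed square (at graph points)
  have hFsq : ∀ x ∈ piece.domain, ∀ s v : ℝ, g x - ε ≤ s → s ≤ g x + ε → 0 ≤ v → v ≤ ε → ¬ (s = g x ∧ v = 0) →
      aeval (ReIm.cplxPoint (Fin.snoc (Fin.snoc x s : Fin (n + 1) → ℝ) v)) F ≠ 0 := by
    intro x hx s v h1 h2 h3 h4 hne
    have hm := hmarg x hx
    exact aeval_cplxPoint_ne_zero_of_isolated hiso hx (by linarith [hm.1]) (by linarith [hm.2])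
      (by rw [abs_of_nonneg h3]; exact h4.trans hεc.le) hne
  have hDr_pt : ∀ x ∈ piece.domain, ∀ s v : ℝ, g x - ε ≤ s → s ≤ g x + ε → 0 ≤ v → v ≤ ε →
      aeval (ReIm.cplxPoint (Fin.snoc (Fin.snoc (Fin.snoc x (g x) : Fin (n + 1) → ℝ) s : Fin (n + 2) → ℝ) v)) Dr ≠ 0 := by
    intro x hx s v h1 h2 h3 h4
    by_cases hsv : s = g x ∧ v = 0
    · obtain ⟨hs, hv⟩ := hsv
      subst hs hv
      rw [ReIm.cplxPoint_snoc_zero, RootIso.aeval_ofReal_comp, Complex.ofReal_ne_zero, rf2 x (g x)]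
      exact hFz x hx
    · exact (ReIm.ratRe_ratIm_hNum_eq rf1 rf3 x (g x) s v (hF x hx) hsv (hFsq x hx s v h1 h2 h3 h4 hsv)).1
  -- the closed inner square (as a band over the band `T`)
  let SqS : Set (Fin (n + 2) → ℝ) :=
    KZlog.band (KZlog.band piece.domain (fun x => g x - ε) (fun x => g x + ε))
      (fun y => (fun _ : Fin n → ℝ => (0:ℝ)) (Fin.init y)) (fun y => (fun _ : Fin n → ℝ => (ε:ℝ)) (Fin.init y))
  have hSq : IsSemialgebraic ℚ SqS :=
    KZlog.isSemialgebraic_band ((isSemialgebraicFunOn_ratCast hT 0).congr (fun _ _ => by simp))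
      ((isSemialgebraicFunOn_ratCast hT ε).congr (fun _ _ => rfl))
  have hSqc : IsCompact SqS := isCompact_band hTc continuousOn_const continuousOn_const
  have hsτ : SqS ⊆ {w | Fin.init (Fin.init w) ∈ piece.domain} := fun w hw => hw.1.1
  have hDr : ∀ w ∈ SqS, aeval (ReIm.cplxPoint (ReIm.gpt g w)) Dr ≠ 0 := by
    intro w hw
    obtain ⟨hx, ⟨h1, h2⟩, ⟨h3, h4⟩⟩ := (mem_band_band_iff w).1 hw
    rw [eq_snoc_snoc w, ReIm.gpt_snoc_snoc]
    exact hDr_pt _ hx _ _ h1 h2 h3 h4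
  have hDden : ∀ w ∈ SqS, aeval (ReIm.cplxPoint (ReIm.gpt g w)) (ReIm.dDen Dr) ≠ 0 := by
    intro w hw
    simp only [ReIm.dDen, map_mul]
    exact mul_ne_zero (hDr w hw) (hDr w hw)
  have hgcc : ContinuousOn (fun w : Fin (n + 2) → ℝ => g (Fin.init (Fin.init w))) SqS :=
    hgc.comp (continuous_init'.comp continuous_init').continuousOn fun w hw => hsτ hw
  -- edge points lie in the square
  have memT : ∀ y ∈ KZlog.band piece.domain (fun x => g x - ε) (fun x => g x + ε),
      (Fin.snoc y (ε:ℝ) : Fin (n + 2) → ℝ) ∈ SqS :=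
    fun y hy => KZlog.snoc_mem_band.2 ⟨hy, hε.le, le_rfl⟩
  have memB : ∀ y ∈ KZlog.band piece.domain (fun x => g x - ε) (fun x => g x + ε),
      (Fin.snoc y (0:ℝ) : Fin (n + 2) → ℝ) ∈ SqS :=
    fun y hy => KZlog.snoc_mem_band.2 ⟨hy, le_rfl, hε.le⟩
  have memR : ∀ y ∈ KZlog.band piece.domain (fun _ => (0:ℝ)) (fun _ => (ε:ℝ)),
      (Fin.snoc (Fin.snoc (Fin.init y) (g (Fin.init y) + (ε:ℝ)) : Fin (n + 1) → ℝ) (y (Fin.last n)) : Fin (n + 2) → ℝ)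
        ∈ SqS := by
    rintro y ⟨hx, h1, h2⟩
    refine KZlog.snoc_mem_band.2 ⟨KZlog.snoc_mem_band.2 ⟨hx, ?_, le_rfl⟩, ?_⟩
    · show g (Fin.init y) - ε ≤ g (Fin.init y) + ε; linarith
    · simpa using And.intro h1 h2
  have memL : ∀ y ∈ KZlog.band piece.domain (fun _ => (0:ℝ)) (fun _ => (ε:ℝ)),
      (Fin.snoc (Fin.snoc (Fin.init y) (g (Fin.init y) - (ε:ℝ)) : Fin (n + 1) → ℝ) (y (Fin.last n)) : Fin (n + 2) → ℝ)
        ∈ SqS := by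
    rintro y ⟨hx, h1, h2⟩
    refine KZlog.snoc_mem_band.2 ⟨KZlog.snoc_mem_band.2 ⟨hx, le_rfl, ?_⟩, ?_⟩
    · show g (Fin.init y) - ε ≤ g (Fin.init y) + ε; linarith
    · simpa using And.intro h1 h2
  -- semialgebraic / continuous remainder data on the square
  have saRe := ReIm.isSemialgebraicFunOn_ratRe_gpt hgτ Nr Dr hSq hsτ hDr
  have saIm := ReIm.isSemialgebraicFunOn_ratIm_gpt hgτ Nr Dr hSq hsτ hDr
  have coRe := ReIm.continuousOn_ratRe_gpt Nr Dr hgcc hDr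
  have coIm := ReIm.continuousOn_ratIm_gpt Nr Dr hgcc hDr
  -- the Green data for the remainder `r = Nr/Dr`
  let rW : IntegralRep (n + 2) := cRep SqS hSq hSqc (fun w => ReIm.ratRe (ReIm.dNum Nr Dr) (ReIm.dDen Dr) (ReIm.gpt g w))
    (ReIm.isSemialgebraicFunOn_ratRe_gpt hgτ (ReIm.dNum Nr Dr) (ReIm.dDen Dr) hSq hsτ hDden)
    (ReIm.continuousOn_ratRe_gpt (ReIm.dNum Nr Dr) (ReIm.dDen Dr) hgcc hDden)
  have hrWd : rW.domain = SqS := rfl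
  let bPr : IntegralRep (n + 1) := cRep _ hT hTc
    (fun y => ReIm.ratIm Nr Dr (ReIm.gpt g (Fin.snoc y (ε:ℝ))) - ReIm.ratIm Nr Dr (ReIm.gpt g (Fin.snoc y (0:ℝ))))
    (IsSemialgebraicFunOn.sub_holds
      (saIm.comp_isSemialgebraicMapOn_holds (isSemialgebraicMapOn_snoc_fun hT (saK hT ε)) (fun y hy => memT y hy))
      (saIm.comp_isSemialgebraicMapOn_holds (isSemialgebraicMapOn_snoc_fun hT (saK0 hT)) (fun y hy => memB y hy)))
    ((coIm.comp (continuousOn_snoc_fun (coK _)) (fun y hy => memT y hy)).sub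
      (coIm.comp (continuousOn_snoc_fun (coK _)) (fun y hy => memB y hy)))
  have hbPrd : bPr.domain = KZlog.band piece.domain (fun x => g x - ε) (fun x => g x + ε) := rfl
  let bQr : IntegralRep (n + 1) := cRep _ hV hVc
    (fun y => ReIm.ratRe Nr Dr (ReIm.gpt g
        (Fin.snoc (Fin.snoc (Fin.init y) (g (Fin.init y) + (ε:ℝ)) : Fin (n + 1) → ℝ) (y (Fin.last n)))) -
      ReIm.ratRe Nr Dr (ReIm.gpt g
        (Fin.snoc (Fin.snoc (Fin.init y) (g (Fin.init y) - (ε:ℝ)) : Fin (n + 1) → ℝ) (y (Fin.last n)))))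
    (IsSemialgebraicFunOn.sub_holds
      (saRe.comp_isSemialgebraicMapOn_holds (isSemialgebraicMapOn_snoc_snoc_fun hV (saGp hV (sub0 rfl)))
        (fun y hy => memR y hy))
      (saRe.comp_isSemialgebraicMapOn_holds (isSemialgebraicMapOn_snoc_snoc_fun hV (saGm hV (sub0 rfl)))
        (fun y hy => memL y hy)))
    ((coRe.comp (continuousOn_snoc_snoc_fun (coGp (sub0 rfl))) (fun y hy => memR y hy)).sub
      (coRe.comp (continuousOn_snoc_snoc_fun (coGm (sub0 rfl))) (fun y hy => memL y hy)))
  have hbQrd : bQr.domain = KZlog.band piece.domain (fun _ => (0:ℝ)) (fun _ => (ε:ℝ)) := rfl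
  have gr : of bQr - of bPr ∈ relations :=
    ReIm.of_sub_of_mem_relations_green_rat_gpt hgτ Nr Dr hgm hgp hK0 hKε
      (fun x hx => by linarith) (fun _ _ => hε.le) rW bPr bQr hrWd hDr (fun _ _ => rfl)
      hbPrd (fun _ _ => rfl) hbQrd (fun _ _ => rfl)
  -- the output representations `E1` (inner vertical edges), `E2` (inner top edge)
  have hD_E1p : ∀ y ∈ KZlog.band piece.domain (fun _ => (0:ℝ)) (fun _ => (ε:ℝ)), aeval (ReIm.cplxPoint
      (Fin.snoc (Fin.snoc (Fin.init y) (g (Fin.init y) + (ε:ℝ)) : Fin (n + 1) → ℝ) (y (Fin.last n)) : Fin (n + 2) → ℝ)) F ≠ 0 := by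
    rintro y ⟨hx, h1, h2⟩
    exact hFsq _ hx _ _ (by linarith) le_rfl h1 h2 (by rintro ⟨h0, -⟩; linarith)
  have hD_E1m : ∀ y ∈ KZlog.band piece.domain (fun _ => (0:ℝ)) (fun _ => (ε:ℝ)), aeval (ReIm.cplxPoint
      (Fin.snoc (Fin.snoc (Fin.init y) (g (Fin.init y) - (ε:ℝ)) : Fin (n + 1) → ℝ) (y (Fin.last n)) : Fin (n + 2) → ℝ)) F ≠ 0 := by
    rintro y ⟨hx, h1, h2⟩
    exact hFsq _ hx _ _ le_rfl (by linarith) h1 h2 (by rintro ⟨h0, -⟩; linarith)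
  have hD_E2 : ∀ y ∈ KZlog.band piece.domain (fun x => g x - ε) (fun x => g x + ε),
      aeval (ReIm.cplxPoint (Fin.snoc y (ε:ℝ) : Fin (n + 2) → ℝ)) F ≠ 0 := by
    rintro y ⟨hx, h1, h2⟩
    rw [← Fin.snoc_init_self y]
    exact hFsq _ hx _ _ h1 h2 hε.le le_rfl (by rintro ⟨-, h0⟩; exact hε.ne' h0)
  let E1 : IntegralRep (n + 1) := cRep _ hV hVc
    (fun y => ReIm.ratRe (ReIm.hNum F) F
        (Fin.snoc (Fin.snoc (Fin.init y) (g (Fin.init y) + (ε:ℝ)) : Fin (n + 1) → ℝ) (y (Fin.last n))) -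
      ReIm.ratRe (ReIm.hNum F) F
        (Fin.snoc (Fin.snoc (Fin.init y) (g (Fin.init y) - (ε:ℝ)) : Fin (n + 1) → ℝ) (y (Fin.last n))))
    (IsSemialgebraicFunOn.sub_holds (sa_Re _ F hV (saGp hV (sub0 rfl)) hD_E1p) (sa_Re _ F hV (saGm hV (sub0 rfl)) hD_E1m))
    ((co_Re _ F (coGp (sub0 rfl)) hD_E1p).sub (co_Re _ F (coGm (sub0 rfl)) hD_E1m))
  have hE1d : E1.domain = KZlog.band piece.domain (fun _ => (0:ℝ)) (fun _ => (ε:ℝ)) := rfl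
  let E2 : IntegralRep (n + 1) := cRep _ hT hTc (fun y => ReIm.ratIm (ReIm.hNum F) F (Fin.snoc y (ε:ℝ)))
    (sa_Im _ F hT (saK hT ε) hD_E2) (co_Im _ F (coK _) hD_E2)
  have hE2d : E2.domain = KZlog.band piece.domain (fun x => g x - ε) (fun x => g x + ε) := rfl
  -- the pole representations `P₁`, `P₂`
  have hQ1 : ∀ z ∈ KZlog.band piece.domain (fun _ => (0:ℝ)) (fun _ => (ε:ℝ)),
      aeval (Fin.snoc z (g (Fin.init z)) : Fin (n + 2) → ℝ)
        (C ε ^ 2 + X (Fin.castSucc (Fin.last n)) ^ 2 : MvPolynomial (Fin (n + 2)) ℚ) ≠ 0 := by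
    intro z _
    simp only [map_add, map_pow, MvPolynomial.aeval_X, MvPolynomial.aeval_C, eq_ratCast, Fin.snoc_castSucc]
    positivity
  have hP1sa : IsSemialgebraicFunOn ℚ (KZlog.band piece.domain (fun _ => (0:ℝ)) (fun _ => (ε:ℝ)))
      (fun z => 2 * g (Fin.init z) * (ε:ℝ) / ((ε:ℝ) ^ 2 + z (Fin.last n) ^ 2)) := by
    refine (sa_polyQuot_graph hV (saG hV (sub0 rfl)) (C (2:ℚ) * C ε * X (Fin.last (n + 1)))
      (C ε ^ 2 + X (Fin.castSucc (Fin.last n)) ^ 2) hQ1).congr fun z _ => ?_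
    simp only [map_add, map_mul, map_pow, MvPolynomial.aeval_X, MvPolynomial.aeval_C, eq_ratCast, Rat.cast_ofNat,
      Fin.snoc_last, Fin.snoc_castSucc]
    ring
  have hP1c : ContinuousOn (fun z : Fin (n + 1) → ℝ => 2 * g (Fin.init z) * (ε:ℝ) / ((ε:ℝ) ^ 2 + z (Fin.last n) ^ 2))
      (KZlog.band piece.domain (fun _ => (0:ℝ)) (fun _ => (ε:ℝ))) :=
    ((continuousOn_const.mul (coG (sub0 rfl))).mul continuousOn_const).div
      (continuousOn_const.add (((continuous_apply _).continuousOn).pow 2)) fun z _ => by positivity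
  let P₁ : IntegralRep (n + 1) := cRep _ hV hVc
    (fun z => 2 * g (Fin.init z) * (ε:ℝ) / ((ε:ℝ) ^ 2 + z (Fin.last n) ^ 2)) hP1sa hP1c
  have hP1d : P₁.domain = KZlog.band piece.domain (fun _ => (0:ℝ)) (fun _ => (ε:ℝ)) := rfl
  have hQ2 : ∀ z ∈ KZlog.band piece.domain (fun x => g x - ε) (fun x => g x + ε),
      aeval (Fin.snoc z (g (Fin.init z)) : Fin (n + 2) → ℝ)
        ((X (Fin.castSucc (Fin.last n)) - X (Fin.last (n + 1))) ^ 2 + C ε ^ 2 : MvPolynomial (Fin (n + 2)) ℚ) ≠ 0 := by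
    intro z _
    simp only [map_add, map_sub, map_pow, MvPolynomial.aeval_X, MvPolynomial.aeval_C, eq_ratCast, Fin.snoc_castSucc,
      Fin.snoc_last]
    positivity
  have hP2sa : IsSemialgebraicFunOn ℚ (KZlog.band piece.domain (fun x => g x - ε) (fun x => g x + ε))
      (fun z => g (Fin.init z) * (ε:ℝ) / ((z (Fin.last n) - g (Fin.init z)) ^ 2 + (ε:ℝ) ^ 2)) := by
    refine (sa_polyQuot_graph hT (saG hT (sub0 rfl)) (C ε * X (Fin.last (n + 1)))
      ((X (Fin.castSucc (Fin.last n)) - X (Fin.last (n + 1))) ^ 2 + C ε ^ 2) hQ2).congr fun z _ => ?_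
    simp only [map_add, map_sub, map_mul, map_pow, MvPolynomial.aeval_X, MvPolynomial.aeval_C, eq_ratCast,
      Fin.snoc_last, Fin.snoc_castSucc]
    ring
  have hP2c : ContinuousOn
      (fun z : Fin (n + 1) → ℝ => g (Fin.init z) * (ε:ℝ) / ((z (Fin.last n) - g (Fin.init z)) ^ 2 + (ε:ℝ) ^ 2))
      (KZlog.band piece.domain (fun x => g x - ε) (fun x => g x + ε)) :=
    ((coG (sub0 rfl)).mul continuousOn_const).div
      (((((continuous_apply _).continuousOn).sub (coG (sub0 rfl))).pow 2).add continuousOn_const)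
      fun z _ => by positivity
  let P₂ : IntegralRep (n + 1) := cRep _ hT hTc
    (fun z => g (Fin.init z) * (ε:ℝ) / ((z (Fin.last n) - g (Fin.init z)) ^ 2 + (ε:ℝ) ^ 2)) hP2sa hP2c
  have hP2d : P₂.domain = KZlog.band piece.domain (fun x => g x - ε) (fun x => g x + ε) := rfl
  -- rA: `E1 = P₁ + bQr` (residue form on the two vertical edges)
  have rA : of E1 - of P₁ - of bQr ∈ relations := by
    refine rel_add E1 P₁ bQr (hP1d.trans hE1d.symm) (hbQrd.trans hE1d.symm) fun z hz => ?_
    obtain ⟨x, v, rfl⟩ : ∃ (x : Fin n → ℝ) (v : ℝ), z = Fin.snoc x v :=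
      ⟨Fin.init z, z (Fin.last n), (Fin.snoc_init_self z).symm⟩
    have hz' : (Fin.snoc x v : Fin (n + 1) → ℝ) ∈ KZlog.band piece.domain (fun _ => (0:ℝ)) (fun _ => (ε:ℝ)) := hz
    obtain ⟨hx, hv0, hvε⟩ := KZlog.snoc_mem_band.1 hz'
    have hRp := (ReIm.ratRe_ratIm_hNum_eq rf1 rf3 x (g x) (g x + (ε:ℝ)) v (hF x hx) (by rintro ⟨h0, -⟩; linarith)
      (hFsq x hx _ _ (by linarith) le_rfl hv0 hvε (by rintro ⟨h0, -⟩; linarith))).2.1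
    have hRm := (ReIm.ratRe_ratIm_hNum_eq rf1 rf3 x (g x) (g x - (ε:ℝ)) v (hF x hx) (by rintro ⟨h0, -⟩; linarith)
      (hFsq x hx _ _ le_rfl (by linarith) hv0 hvε (by rintro ⟨h0, -⟩; linarith))).2.1
    show _ - _ = _ / _ + (_ - _)
    simp only [Fin.init_snoc, Fin.snoc_last, ReIm.gpt_snoc_snoc]
    rw [hRp, hRm]
    have e1 : g x + (ε:ℝ) - g x = ε := by ring
    have e2 : g x - (ε:ℝ) - g x = -ε := by ring
    rw [e1, e2]
    ring
  -- rB: `bPr = E2 + P₂` (residue form on the top edge; the bottom edge carries `Im r = 0`)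
  have rB : of bPr - of E2 - of P₂ ∈ relations := by
    refine rel_add bPr E2 P₂ (hE2d.trans hbPrd.symm) (hP2d.trans hbPrd.symm) fun z hz => ?_
    obtain ⟨x, u, rfl⟩ : ∃ (x : Fin n → ℝ) (u : ℝ), z = Fin.snoc x u :=
      ⟨Fin.init z, z (Fin.last n), (Fin.snoc_init_self z).symm⟩
    have hz' : (Fin.snoc x u : Fin (n + 1) → ℝ) ∈ KZlog.band piece.domain (fun x => g x - ε) (fun x => g x + ε) := hz
    obtain ⟨hx, hu1, hu2⟩ := KZlog.snoc_mem_band.1 hz'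
    have hIm := (ReIm.ratRe_ratIm_hNum_eq rf1 rf3 x (g x) u (ε:ℝ) (hF x hx) (by rintro ⟨-, h0⟩; exact hε.ne' h0)
      (hFsq x hx _ _ hu1 hu2 hε.le le_rfl (by rintro ⟨-, h0⟩; exact hε.ne' h0))).2.2
    show _ - _ = ReIm.ratIm (ReIm.hNum F) F (Fin.snoc (Fin.snoc x u : Fin (n + 1) → ℝ) (ε:ℝ)) + _ / _
    simp only [Fin.init_snoc, Fin.snoc_last, ReIm.gpt_snoc_snoc, ReIm.ratIm_snoc_zero, sub_zero]
    rw [hIm]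
    ring
  -- assemble
  refine ⟨P₁, P₂, E1, E2, hP1d, fun _ _ => rfl, hP2d, fun _ _ => rfl, ⟨hE1d, fun _ _ => rfl⟩, ⟨hE2d, fun _ _ => rfl⟩, ?_⟩
  have key : of E1 - of E2 - (of P₁ + of P₂) =
      (of E1 - of P₁ - of bQr) + (of bQr - of bPr) + (of bPr - of E2 - of P₂) := by abel
  rw [key]
  exact add_mem (add_mem rA gr) rB

/-- Two representations with the same edge spec agree modulo relations. -/
theorem of_sub_of_eq_spec {m : ℕ} {r r' : IntegralRep m} {D : Set (Fin m → ℝ)} {f : (Fin m → ℝ) → ℝ}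
    (hd : r.domain = D) (hi : ∀ z ∈ r.domain, r.integrand z = f z)
    (hd' : r'.domain = D) (hi' : ∀ z ∈ r'.domain, r'.integrand z = f z) : of r - of r' ∈ relations :=
  of_sub_of_mem_relations_of_eqOn (hd'.trans hd.symm) fun z hz => by
    rw [hi z hz, hi' z (by rw [hd']; rw [hd] at hz; exact hz)]

/-- **GLUE (kernel-checked): `OuterGreen → InnerResidue → OuterInSector → GreenReduction`.**
`[P₁]+[P₂] = (−A − C₁ + C₂ + B) + ([BQ] − [BP])` with `A, B` the two relations of S1, S2 and `C₁, C₂` the spec-uniqueness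
relations between the two copies of `E1`, `E2`. -/
theorem greenReduction_of (h1 : OuterGreen) (h2 : InnerResidue) (h3 : OuterInSector) : GreenReduction := by
  intro n g U piece F lo hi a b c ε hU hsub hg han hlohi hdom hint hF hFz hiso
  obtain ⟨E1, E2, BQ, BP, hE1, hE2, hBQ, hBP, hB⟩ :=
    h1 n g U piece F lo hi a b c ε hU hsub hg han hlohi hdom hint hF hFz hiso
  obtain ⟨P₁, P₂, E1', E2', hP₁d, hP₁i, hP₂d, hP₂i, hE1', hE2', hA⟩ :=
    h2 n g U piece F lo hi a b c ε hU hsub hg han hlohi hdom hint hF hFz hiso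
  obtain ⟨hQ, hP⟩ := h3 n g U piece F lo hi a b c ε hU hsub hg han hlohi hdom hint hF hFz hiso BQ BP hBQ hBP
  have hC1 : of E1 - of E1' ∈ relations := of_sub_of_eq_spec hE1.1 hE1.2 hE1'.1 hE1'.2
  have hC2 : of E2 - of E2' ∈ relations := of_sub_of_eq_spec hE2.1 hE2.2 hE2'.1 hE2'.2
  have hrel : -(of E1' - of E2' - (of P₁ + of P₂)) - (of E1 - of E1') + (of E2 - of E2') +
      (of E1 - of E2 - (of BQ - of BP)) ∈ relations :=
    add_mem (add_mem (sub_mem (neg_mem hA) hC1) hC2) hB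
  have hsec : of BQ - of BP ∈ AddSubgroup.closure RatBoxSet :=
    sub_mem (AddSubgroup.subset_closure hQ) (AddSubgroup.subset_closure hP)
  refine ⟨P₁, P₂, hP₁d, hP₁i, hP₂d, hP₂i, ?_⟩
  have : of P₁ + of P₂ = (-(of E1' - of E2' - (of P₁ + of P₂)) - (of E1 - of E1') + (of E2 - of E2') +
      (of E1 - of E2 - (of BQ - of BP))) + (of BQ - of BP) := by abel
  rw [this]
  exact add_mem (AddSubgroup.mem_sup_left hrel) (AddSubgroup.mem_sup_right hsec)

/-- **`GreenReduction` HOLDS**: S1 (`outerGreen_holds`), S2 (`innerResidue_holds`), S3 (`outerInSector_holds`) are all PROVED. -/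
theorem greenReduction_holds : GreenReduction :=
  greenReduction_of outerGreen_holds innerResidue_holds outerInSector_holds

/-- **`BoxRescale` holds** (PROVED: one affine change-of-variables move, `exists_cube_of_ratBox`). -/
theorem boxRescale_holds : BoxRescale := by
  rintro y ⟨m, q, lo, hi, P, Q, hlohi, hdom, hQ, hint, rfl⟩
  obtain ⟨q', P', Q', h1, h2, h3, h4⟩ := exists_cube_of_ratBox q lo hi P Q hlohi hdom hQ hint
  have hq' : of q' ∈ AddSubgroup.closure ratCubeSet :=
    AddSubgroup.subset_closure ⟨m, q', P', Q', h1, h2, h3, rfl⟩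
  have h : of q = -(of q' - of q) + of q' := by abel
  rw [h]
  exact add_mem (AddSubgroup.mem_sup_left (neg_mem h4)) (AddSubgroup.mem_sup_right hq')

/-- **`BoxChain ⟸ GreenReduction ∧ BoxRescale`** (kernel-checked; uses the PROVED `poleContribution`:
`[P₁] + [P₂] − [π]·[piece] ∈ relations`, fibred translation + half winding number + commutator). -/
theorem boxChain_of (hG : GreenReduction) (hR : BoxRescale) : BoxChain := by
  intro n g U piece F lo hi a b c ε hU hsub hg han hlohi hdom hint hF hFz hiso
  obtain ⟨P₁, P₂, hP₁d, hP₁i, hP₂d, hP₂i, hmem⟩ :=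
    hG n g U piece F lo hi a b c ε hU hsub hg han hlohi hdom hint hF hFz hiso
  have hε : 0 < ε := hiso.2.1
  have hpole : of P₁ + of P₂ - of piRep * of piece ∈ relations :=
    poleContribution ε hε g (fun x hx => (han x (hsub hx)).differentiableAt) piece rfl hint P₁ P₂
      hP₁d hP₁i hP₂d hP₂i
  have hle : relations ⊔ AddSubgroup.closure RatBoxSet ≤ relations ⊔ AddSubgroup.closure ratCubeSet :=
    sup_le le_sup_left ((AddSubgroup.closure_le _).2 fun y hy => hR y hy)
  have h := sub_mem (hle hmem) (AddSubgroup.mem_sup_left (T := AddSubgroup.closure ratCubeSet) hpole)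
  rwa [sub_sub_cancel] at h

/-- `BoxChain` (statement B) HOLDS — derived from the PROVED `GreenReduction` and `BoxRescale`. -/
theorem boxChain_holds : BoxChain := boxChain_of greenReduction_holds boxRescale_holds

/-! ### Composition (kernel-checked) -/

/-- **Route item 27842 `PiRationalisationSimpleBranch` HOLDS** (the route decl BY NAME; std axioms).
`K₀ = 1`: root isolation on a rational grid (`rootIsolation_holds`) gives `[s] ≡ Σ_j [piece_j]`; then
`[π]·[s] = [π]·([s] − Σ[pieces]) + Σ_j [π]·[piece_j]`, the first term a relation (right ideal) and each summand in
`relations ⊔ ⟨rational closed-cube sector⟩` by the box chain (`boxChain_holds` = Green ×4 on the upper half-annulus +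
residue at the simple real root + box rescaling); higher `K` by item 26388 `PiTimesSector`
(`Summit.KontsevichZagierPeriods.RootDecompRationalCubeDichotomy.piTimesSector_proof`, in tree). -/
theorem piRationalisationSimpleBranch_proof : PiRationalisationSimpleBranch := by
  intro n g U s F hU hsub hg han hF hFz hsd hsi
  obtain ⟨k, lo, hi, piece, a, b, c, ε, hlohi, hdom, hsubc, hint, hrel, hiso⟩ :=
    rootIsolation_holds n g U s F hU hsub hg han hF hFz hsd hsi
  refine ⟨1, fun K hK => ?_⟩
  obtain ⟨K', rfl⟩ := Nat.exists_eq_add_of_le hK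
  have h1 : of piRep * of s ∈ relations ⊔ AddSubgroup.closure ratCubeSet := by
    have : of piRep * of s =
        of piRep * (of s - ∑ j, of (piece j)) + ∑ j, of piRep * of (piece j) := by
      rw [mul_sub, Finset.mul_sum]; abel
    rw [this]
    refine add_mem (AddSubgroup.mem_sup_left (piRep_mul_mem_relations hrel))
      (sum_mem fun j _ => ?_)
    exact boxChain_holds n g U (piece j) F (lo j) (hi j) (a j) (b j) (c j) (ε j) hU ((hsubc j).trans hsub) hg han
      (hlohi j) (hdom j) (hint j) (fun x hx => hF x (hsubc j hx)) (fun x hx => hFz x (hsubc j hx))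
      (hiso j)
  rw [show 1 + K' = K' + 1 from add_comm _ _, Function.iterate_succ_apply]
  exact piIter_mem_sup Summit.KontsevichZagierPeriods.RootDecompRationalCubeDichotomy.piTimesSector_proof K' h1

end Summit.KontsevichZagierPeriods.RootDecompRationalCubeDichotomy.Rung27842.SimpleBranch

end

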